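import Literature.NumberTheory.DiophantineGeometry.AbcStewartYu2001
import Literature.NumberTheory.DiophantineGeometry.AbcWave0SUnitProofs
import HarnessLib

/-!
# Pasten 2024, Theorem 1.4 (2) implies Stewart–Yu 2001, Theorem 2 (PROOF companion)

Topic `NumberTheory/DiophantineGeometry`; namespace `Literature.NumberTheory.DiophantineGeometry`
(sub-namespace `StewartYu2001`). Companion of `AbcStewartYu2001.lean` (the typed Theorem 2,
`stewartYu2001_thm2`); everything here is PROVED, no definition, no named fact.

Pasten, Invent. Math. 236 (2024), §1: the bound (ii) of Stewart–Yu [14],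
`log c ≤ q · exp(κ (log₃ R / log₂ R) log R)`, `q = min{𝒫(a), 𝒫(b), 𝒫(c)}`, and "Our method gives a
substantial improvement on both bounds: … (2) `log c ≤ q · exp(κ √((log R) log₂ R))`"
[Pasten2024, §1 (ii), Thm 1.4 (2)]. The word "improvement" is made a kernel implication between the
two named facts of the tree:

* `StewartYu2001.stewartYu2001_thm2_of_pasten2024 :
    Literature.Barriers.ABC.pasten2024_thm_1_4_2 → stewartYu2001_thm2`.

Proof. (Large radical.) For `R ≥ R₁ := max(R₀, 16, exp exp exp 1)` (`R₀` = Pasten's threshold) put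
`L = log R ≥ e^e`; then `(log L)³ < 27 L` (`t < e^t` at `t = log L / 3`) gives
`√(L log L) · log L = √(L (log L)³) < 6 L`, whence `κ √(L log L) < 6κ · L · log₂ L / log L`
(`log₂ L ≥ 1`), i.e. Pasten's `exp(κ √(L log L))` is `< R^{6κ · log₃ R / log₂ R}`; so the printed
sentence holds with any constant `C ≥ 6κ` (`StewartYu2001.bound_mono`). (Small radical.) The abc
triples with `rad < R₁` have all prime factors `< R₁`, hence are finitely many by the `S`-unit
theorem over `ℚ` PROVED in the tree (`finite_setOf_isABCTriple_primeFactors_subset_holds`,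
Mahler 1933); for each of them with `z > 2` the bound `p′ · G^{C s}` (`s = log₃ G⋆ / log₂ G > 0`,
`G ≥ 6`) exceeds `log z` as soon as `C ≥ log z / (s log G)` (`e^u > u`), and a finite set of
thresholds is bounded. The constant is `C = max(6κ, B, 1)`.

Consequently the trust base of `stewartYu2001_thm2` is contained in that of
`pasten2024_thm_1_4_2`, i.e. (via `Literature.Barriers.ABC.pasten2024_thm_1_4_2_of`) in
{`Dioph.evertseGyory_thm_4_2_1_rat`, `pasten2024_thm_2_5`} — the second (Shimura curves) being of
course foreign to the 2001 proof, which uses logarithmic forms only (Yu 1998/1999 + an archimedean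
estimate); a derivation of `stewartYu2001_thm2` from `PastenApproximationBound K` alone (the
tree's rendering of the logarithmic-form input, from which Theorem 1 = `stewart_yu` is already
derived in `BakerMethodBoundsProofs`, `bakerShapeBound_third_three_of_approximationBound`) is the
natural A1.M3⁺ prover target and is NOT attempted here.

## References

* [Pasten2024] H. Pasten, Invent. Math. 236 (2024) 373–385, arXiv:2312.03566 — §1 (ii), Thm 1.4 (2).
* [StewartYu2001] C. L. Stewart, K. Yu, Duke Math. J. 108 (2001) 169–181 — Theorem 2.
* [Mahler1933a] K. Mahler, Math. Ann. 107 (1933) — the `S`-unit theorem over `ℚ` (tree-proved).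
-/

noncomputable section

open Literature.Barriers.ABC

namespace Literature.NumberTheory.DiophantineGeometry

namespace StewartYu2001


/-- `(log L)^3 < 27 L` for `L ≥ 1`: with `t = log L / 3`, `t < e^t` gives `t^3 < e^{3t} = L`.
[folklore] -/
private theorem log_pow_three_lt {L : ℝ} (hL : 1 ≤ L) : Real.log L ^ 3 < 27 * L := by
  have hL0 : 0 < L := by linarith
  set t : ℝ := Real.log L / 3 with ht
  have ht0 : 0 ≤ t := by rw [ht]; exact div_nonneg (Real.log_nonneg hL) (by norm_num)
  have hlt : t < Real.exp t := by have := Real.add_one_le_exp t; linarith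
  have hexp3 : Real.exp t ^ 3 = L := by
    rw [← Real.exp_nat_mul, ht]
    have : ((3 : ℕ) : ℝ) * (Real.log L / 3) = Real.log L := by push_cast; ring
    rw [this, Real.exp_log hL0]
  have ht3 : t ^ 3 < Real.exp t ^ 3 := by
    exact pow_lt_pow_left₀ hlt ht0 (by norm_num)
  have hlog : Real.log L = 3 * t := by rw [ht]; ring
  rw [hlog]
  nlinarith

/-- For `L ≥ e^e` (so `log L ≥ e`, `log₂ L ≥ 1`) and `κ > 0`:
`κ √(L log L) < L · (6κ · log₂ L / log L)` — Pasten's exponent is below Stewart–Yu's with constant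
`6κ`. [folklore] -/
private theorem sqrt_bound {κ L : ℝ} (hκ : 0 < κ) (hL : Real.exp (Real.exp 1) ≤ L) :
    κ * Real.sqrt (L * Real.log L) < L * (6 * κ * Real.log (Real.log L) / Real.log L) := by
  have he1 : 1 ≤ Real.exp 1 := by have := Real.add_one_le_exp (1:ℝ); linarith
  have hL1 : 1 ≤ L := le_trans (by linarith [Real.add_one_le_exp (Real.exp 1)]) hL
  have hL0 : 0 < L := by linarith
  have hlogL : Real.exp 1 ≤ Real.log L := by
    rw [Real.le_log_iff_exp_le hL0]; exact hL
  have hlogL1 : 1 ≤ Real.log L := le_trans he1 hlogL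
  have hlogL0 : 0 < Real.log L := by linarith
  have hll : 1 ≤ Real.log (Real.log L) := by
    rw [Real.le_log_iff_exp_le hlogL0]; exact hlogL
  -- √(L log L) < 6 L / log L
  have hsqrt : Real.sqrt (L * Real.log L) < 6 * L / Real.log L := by
    rw [Real.sqrt_lt' (by positivity), div_pow, lt_div_iff₀ (by positivity)]
    have h27 := log_pow_three_lt hL1
    nlinarith
  calc κ * Real.sqrt (L * Real.log L) < κ * (6 * L / Real.log L) :=
        mul_lt_mul_of_pos_left hsqrt hκ
    _ = L * (6 * κ * 1 / Real.log L) := by ring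
    _ ≤ L * (6 * κ * Real.log (Real.log L) / Real.log L) := by
        apply mul_le_mul_of_nonneg_left _ hL0.le
        apply div_le_div_of_nonneg_right _ hlogL0.le
        nlinarith

/-- `thm2Exponent C G = C · thm2Exponent 1 G`: the constant of Theorem 2 factors out of the
exponent `C · log₃ G⋆ / log₂ G`. [cite: StewartYu2001, Theorem 2] -/
theorem thm2Exponent_eq_mul (C G : ℝ) : thm2Exponent C G = C * thm2Exponent 1 G := by
  unfold thm2Exponent; ring

/-- **Pasten 2024, Theorem 1.4 (2) implies Stewart–Yu 2001, Theorem 2** ("Our method gives a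
substantial improvement on both bounds"): `exp(κ √(log R · log₂ R)) < R^{6κ log₃ R / log₂ R}` once
`log R ≥ e^e`, and the finitely many abc triples of smaller radical (`S`-unit theorem, tree-proved)
are absorbed by enlarging the constant. [cite: Pasten2024, §1 (ii) and Thm 1.4 (2)]
[cite: StewartYu2001, Theorem 2] -/
theorem stewartYu2001_thm2_of_pasten2024 (h : pasten2024_thm_1_4_2) : stewartYu2001_thm2 := by
  obtain ⟨κ, hκ, R₀, hP⟩ := h
  rw [stewartYu2001_thm2_iff]
  -- thresholds
  set R₁ : ℝ := max R₀ (max 16 (Real.exp (Real.exp (Real.exp 1)))) with hR₁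
  -- the finite set of small triples
  set N : ℕ := ⌈R₁⌉₊ + 1 with hN
  have hfin := finite_setOf_isABCTriple_primeFactors_subset_holds (Finset.range N)
  -- threshold function on triples
  set f : ℕ × ℕ × ℕ → ℝ := fun t =>
    Real.log t.2.2 / (thm2Exponent 1 (rad t.1 t.2.1 t.2.2) * Real.log (rad t.1 t.2.1 t.2.2 : ℕ))
    with hf
  obtain ⟨B, hB⟩ := (hfin.image f).bddAbove
  refine ⟨max (6 * κ) (max B 1),
    lt_of_lt_of_le one_pos (le_trans (le_max_right _ _) (le_max_right _ _)), fun x y z ht hz => ?_⟩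
  have hz0 : (0 : ℝ) < z := by exact_mod_cast lt_trans two_pos hz
  have hR6 : (6 : ℝ) ≤ (rad x y z : ℝ) := by exact_mod_cast six_le_rad ht hz
  have hR0 : (0 : ℝ) < (rad x y z : ℝ) := by linarith
  have hq1 : (1 : ℝ) ≤ (pmin x y z : ℝ) := by exact_mod_cast one_le_pmin x y z
  rw [← Real.log_lt_iff_lt_exp hz0]
  by_cases hlarge : R₁ ≤ (rad x y z : ℝ)
  · -- large radical: Pasten's bound, then the comparison of exponents
    have hR₀ : R₀ ≤ (rad x y z : ℝ) := le_trans (le_max_left _ _) hlarge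
    have h16 : (16 : ℝ) ≤ (rad x y z : ℝ) :=
      le_trans (le_trans (le_max_left _ _) (le_max_right _ _)) hlarge
    have hee : Real.exp (Real.exp (Real.exp 1)) ≤ (rad x y z : ℝ) :=
      le_trans (le_trans (le_max_right _ _) (le_max_right _ _)) hlarge
    have hPx := hP x y z ht hR₀
    set L : ℝ := Real.log (rad x y z : ℕ) with hL
    have hLee : Real.exp (Real.exp 1) ≤ L := by
      rw [hL, Real.le_log_iff_exp_le hR0]; exact hee
    have hcmp := sqrt_bound hκ hLee
    -- exponent identity
    have hexpo : L * (6 * κ * Real.log (Real.log L) / Real.log L) =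
        Real.log (rad x y z : ℕ) * thm2Exponent (6 * κ) (rad x y z) := by
      rw [thm2Exponent_def, max_eq_left h16]
    have hmono := bound_mono ht hz (le_max_left (6 * κ) (max B 1))
    calc Real.log z ≤ (pmin x y z : ℝ) * Real.exp (κ * Real.sqrt (L * Real.log L)) := by
          rw [pmin_def]; exact hPx
      _ < (pmin x y z : ℝ) * Real.exp (L * (6 * κ * Real.log (Real.log L) / Real.log L)) := by
          apply mul_lt_mul_of_pos_left _ (by linarith)
          exact Real.exp_lt_exp.mpr hcmp
      _ = (pmin x y z : ℝ) * (rad x y z : ℝ) ^ thm2Exponent (6 * κ) (rad x y z) := by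
          rw [hexpo, Real.rpow_def_of_pos hR0]
      _ ≤ (pmin x y z : ℝ) * (rad x y z : ℝ) ^ thm2Exponent (max (6 * κ) (max B 1)) (rad x y z) :=
          hmono
  · -- small radical: one of finitely many triples
    push Not at hlarge
    have hmem : (x, y, z) ∈ {t : ℕ × ℕ × ℕ | IsABCTriple t.1 t.2.1 t.2.2 ∧
        (t.1 * t.2.1 * t.2.2).primeFactors ⊆ Finset.range N} := by
      refine ⟨ht, fun p hp => ?_⟩
      rw [Finset.mem_range]
      have hple : p ≤ rad x y z :=
        Nat.le_of_dvd (by rw [rad_def]; exact Nat.radical_pos _)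
          (by rw [rad_def]; exact Nat.dvd_of_mem_primeFactors (by rw [Nat.primeFactors_radical]; exact hp))
      have h1 : (p : ℝ) < R₁ := lt_of_le_of_lt (by exact_mod_cast hple) hlarge
      have h2 : (p : ℝ) < ⌈R₁⌉₊ := lt_of_lt_of_le h1 (Nat.le_ceil R₁)
      have h3 : p < ⌈R₁⌉₊ := by exact_mod_cast h2
      omega
    have hfB : f (x, y, z) ≤ B := hB (Set.mem_image_of_mem f hmem)
    have hs : 0 < thm2Exponent 1 (rad x y z) := thm2Exponent_pos one_pos (by linarith)
    have hlogR : 0 < Real.log (rad x y z : ℕ) := Real.log_pos (by linarith)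
    have hfle : Real.log z ≤ B * (thm2Exponent 1 (rad x y z) * Real.log (rad x y z : ℕ)) := by
      have := hfB; rw [hf] at this; dsimp only at this
      rwa [div_le_iff₀ (by positivity)] at this
    set C : ℝ := max (6 * κ) (max B 1) with hC
    have hBC : B ≤ C := le_trans (le_max_left _ _) (le_max_right _ _)
    have hCpos : 0 < C := lt_of_lt_of_le one_pos (le_trans (le_max_right _ _) (le_max_right _ _))
    -- log z ≤ C s log R < exp (C s log R) = R ^ thm2Exponent C R ≤ pmin * R ^ ...
    have h1 : Real.log z ≤ Real.log (rad x y z : ℕ) * thm2Exponent C (rad x y z) := by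
      rw [thm2Exponent_eq_mul C]
      calc Real.log z ≤ B * (thm2Exponent 1 (rad x y z) * Real.log (rad x y z : ℕ)) := hfle
        _ ≤ C * (thm2Exponent 1 (rad x y z) * Real.log (rad x y z : ℕ)) :=
            mul_le_mul_of_nonneg_right hBC (by positivity)
        _ = Real.log (rad x y z : ℕ) * (C * thm2Exponent 1 (rad x y z)) := by ring
    have h2 : Real.log (rad x y z : ℕ) * thm2Exponent C (rad x y z) <
        (rad x y z : ℝ) ^ thm2Exponent C (rad x y z) := by
      rw [Real.rpow_def_of_pos hR0]
      have := Real.add_one_le_exp (Real.log (rad x y z : ℕ) * thm2Exponent C (rad x y z))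
      linarith
    calc Real.log z < (rad x y z : ℝ) ^ thm2Exponent C (rad x y z) := lt_of_le_of_lt h1 h2
      _ = 1 * (rad x y z : ℝ) ^ thm2Exponent C (rad x y z) := (one_mul _).symm
      _ ≤ (pmin x y z : ℝ) * (rad x y z : ℝ) ^ thm2Exponent C (rad x y z) :=
          mul_le_mul_of_nonneg_right hq1 (Real.rpow_nonneg hR0.le _)

end StewartYu2001

end Literature.NumberTheory.DiophantineGeometry
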